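import Summits.CriticalPhenomena.SAWScalingLimit.Theorems.SAWDevelopingMapHexConjectureAvoidanceCocycle
import Summits.CriticalPhenomena.SAWScalingLimit.Theorems.SAWDevelopingMapObservableToSLEHullApproxLimit
import Summits.CriticalPhenomena.SAWScalingLimit.Theorems.SAWDevelopingMapObservableToSLEHullApproxDomain
import Summits.CriticalPhenomena.SAWScalingLimit.Theorems.SAWDevelopingMapObservableToSLERestrictionCocycle
import Summits.CriticalPhenomena.SAWScalingLimit.Theorems.SAWDevelopingMapObservableToSLEShortChordLocalityHelpers
import Literature.Probability.RandomPlanarGeometry.RestrictionHullsProofs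
import Literature.Probability.RandomPlanarGeometry.RestrictionHullsRiemannProofs
import Literature.Probability.RandomPlanarGeometry.JordanDomainProofs
import HarnessLib

/-!
# Crux `HexConjecture` (stmt-CriticalPhenomena-0808), line `root-locality-replaces-loewner`:
the floor-class avoidance cocycle from the CANONICAL restriction limit, and from ARCH TIGHTNESS

Landing target:
`Summits/CriticalPhenomena/SAWScalingLimit/Theorems/SAWDevelopingMapHexConjectureAvoidanceCocycleArch.lean`
(`--supports stmt-CriticalPhenomena-0808`; lead continuation prover-line-stmt-CriticalPhenomena-0808-c1-0).

Two pieces of glue over LANDED theorems, recorded because they change the shape of the line: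

* `hexAvoidanceCocycleFloor_of_floorRestrictionLimit` — the SANDWICH, isolated: crux-10472's canonical
  restriction limit `FloorRestrictionLimit` (probability that the critical SAW of `Ω_δ` is a mesh walk of the
  hull subdomain `D'` tends to `Φ_A'(0)^{5/8}`, floor class, floor-vertex endpoints) implies this line's
  `HexAvoidanceCocycleFloor` (probability of the CLOSED curve-space event `{range ⊆ closure D'}` tends to the
  chordal SLE(8/3) value `μ {range ⊆ closure D'}`, discrete-boundary endpoints): restriction data and the LSW
  value (`stub_avoidanceCocycle_restrictionData`, `measure_rangeSubset_closure_eq_of_isSLELaw`), discrete-boundary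
  endpoints are floor vertices inside the flat balls (`stub_avoidanceCocycle_floorEndpoint`), and the squeeze
  `mesh(D') ⊆ {range ⊆ cl D'} ⊆ mesh(D'')` through the hull approximation `FloorRatio.hullApprox` (p114707).
  (The previous lead's `hexAvoidanceCocycle_floor_of_hullApprox` inlines the same squeeze for the root-dominance
  input; here the input is the abstract `FloorRestrictionLimit`, so that EITHER lever feeds it.)
* `hexAvoidanceCocycleFloor_of_archTightness` — the line's lever in its POSITIVE form (line card, "Hardest stub",
  attack (B): σ = 0 root locality + boundary calibration) is crux-10472's chain, all landed:
  `HexObservableLimitR` (= `SAWDevelopingMap.HexObservableLimit`, identical bodies) `→ HalfPlaneArchTightness →`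
  short-chord locality (`FloorRatio.stub_shortChordLocality_reduction`, p74295) `→` admissible restriction limit
  (`FloorRatio.stub_restrictionCocycle`, p90257) `→` canonical (`FloorRatio.canonicalTransfer_of_hullApprox` p94044 +
  `FloorRatio.hullApprox`) `→ HexAvoidanceCocycleFloor` (this file).  Hence on the floor class the avoidance cocycle —
  and with it this line's range identification — hinges on DCS Conj. 2 plus ONE positive arch-tightness estimate,
  the same registered open stub `stub_halfPlaneArchTightness` as crux stmt-CriticalPhenomena-10472.

References: Lawler–Schramm–Werner, *Conformal restriction: the chordal case*, JAMS 16 (2003), Thm. 6.1, Lemma 3.5;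
Lawler–Schramm–Werner, *On the scaling limit of planar self-avoiding walk* (2004), §3.4, Prop. 2.
-/

noncomputable section

open scoped Topology NNReal ENNReal
open Filter Set Metric MeasureTheory
open Literature.Probability.LatticeModels (HexVertex hexGraph hexCenter)
open Literature.Probability.RandomPlanarGeometry
open Literature.Probability.RandomPlanarGeometry.SAW
open UpperHalfPlane (upperHalfPlaneSet)
open Summit.CriticalPhenomena.SAWScalingLimit.Theorems.ObservableToSLE.FloorRatio
  (canonicalTransfer_of_hullApprox stub_hullApproxLimit stub_hullApproxDomain stub_restrictionCocycle
    stub_shortChordLocality_reduction eventually_adj_mem_ball curve_mem_rangeSubset_of_meshWalk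
    eventually_ne_of_tendsto_hexCenter)
open Summit.CriticalPhenomena.SAWScalingLimit.Theorems.ObservableToSLE.Negative
  (eventually_isProbabilityMeasure_hexSAWLaw)
open Summit.CriticalPhenomena.SAWScalingLimit.Theorems.AvoidanceOfLimit (segment_subset_range_toCurve)
open Summit.CriticalPhenomena.SAWScalingLimit.Theorems.HexConjecture.RootLocality.Cocycle
  (measure_rangeSubset_closure_eq_of_isSLELaw tendsto_of_eventually_between)

namespace Summit.CriticalPhenomena.SAWScalingLimit.Theorems.HexConjecture.RootLocality

/-- **(HA) hull approximation from outside** — verbatim crux-10472's `FloorRatio.hullApprox` (landed in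
`…ObservableToSLEFloorPart.lean`, p114707), re-assembled here from its two landed halves `stub_hullApproxLimit` (p98031)
and `stub_hullApproxDomain` (p112182) so that this file does not depend on the freshest module: every hull subdomain
`D'` of a Dobrushin domain is approximated by Jordan hull subdomains `D'' ⊇ D'` swallowing a metric collar of `D'` with
`Φ'_{A''}(0)^{5/8} ≤ (1+ε) Φ'_A(0)^{5/8}`.
[cite: LawlerSchrammWerner2003Restriction, Lemma 3.5 and its proof (p. 12)] -/
private theorem hullApprox_rootLocality :
    ∀ (D D' : DobrushinDomain), D.IsHullSubdomain D' →
      ∀ (φ : ConformalEquiv upperHalfPlaneSet D.carrier)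
      (Φ : ConformalEquiv (upperHalfPlaneSet \ φ.pullbackHull D') upperHalfPlaneSet) (d : ℝ),
      D.IsChordalUniformizing φ → IsRestrictionMap (φ.pullbackHull D') Φ →
      HasRestrictionDeriv (φ.pullbackHull D') Φ d →
      ∀ ε : ℝ, 0 < ε → ∃ (D'' : DobrushinDomain)
        (Φ'' : ConformalEquiv (upperHalfPlaneSet \ φ.pullbackHull D'') upperHalfPlaneSet) (d'' η : ℝ),
        D.IsHullSubdomain D'' ∧ D'.carrier ⊆ D''.carrier ∧ 0 < η ∧
        (∀ z ∈ D.carrier, Metric.infDist z D'.carrier ≤ η → z ∈ D''.carrier) ∧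
        IsRestrictionMap (φ.pullbackHull D'') Φ'' ∧ HasRestrictionDeriv (φ.pullbackHull D'') Φ'' d'' ∧
        d'' ^ ((5 : ℝ) / 8) ≤ (1 + ε) * d ^ ((5 : ℝ) / 8) := by
  intro D D' hD' φ Φ d hφ hΦ hd ε hε
  obtain ⟨B, r, hB, hBA, hr, hfar, hbound⟩ := stub_hullApproxLimit D D' φ Φ d hD' hφ hΦ hd ε hε
  obtain ⟨D'', η, hD'', hsub, hη, hcollar, hBD''⟩ :=
    stub_hullApproxDomain D D' φ B r hD' hφ hB hBA hr hfar
  have hA'' : IsStarHull (φ.pullbackHull D'') :=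
    IsStarHull.pullbackHull JordanDomain.isSimplyConnected_holds hφ hD''
  obtain ⟨Φ'', hΦ'', -⟩ := IsStarHull.existsUnique_isRestrictionMap_holds hA''
  obtain ⟨d'', -, -, hd''⟩ := IsStarHull.exists_hasRestrictionDeriv_holds hA'' hΦ''
  exact ⟨D'', Φ'', d'', η, hD'', hsub, hη, hcollar, hΦ'', hd'',
    hbound D'' Φ'' d'' hD'' hBD'' hΦ'' hd''⟩

/-- **The sandwich: canonical restriction limit (floor class, mesh-walk events, floor-vertex endpoints) ⟹ the
avoidance cocycle with the SLE(8/3) value (closed range events, discrete-boundary endpoints).**  For a floor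
domain `D`, a hull subdomain `D'` and any chordal SLE(8/3) law `μ` of `D`:
`P_δ[range γ_δ ⊆ cl D'] → μ {range ⊆ cl D'} = Φ_A'(0)^{5/8}`, given that the mesh-walk probabilities converge to
`Φ_{A''}'(0)^{5/8}` for EVERY hull subdomain `D''` (the hypothesis, applied to `D'` from below and to the
`FloorRatio.hullApprox` super-domains `D'' ⊇ collar(D')` from above).
[cite: LawlerSchrammWerner2004SAW, §3.4 ("SAW satisfies restriction") and Prop. 2] -/
theorem hexAvoidanceCocycleFloor_of_floorRestrictionLimit
    (hFRL : ∀ (D D' : DobrushinDomain) (ρ : ℝ) (φ : ConformalEquiv upperHalfPlaneSet D.carrier)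
      (Φ : ConformalEquiv (upperHalfPlaneSet \ φ.pullbackHull D') upperHalfPlaneSet) (d : ℝ)
      (a b : ℝ → HexVertex),
      (0 < ρ ∧ (D.pt 1).im = (D.pt 0).im ∧ D.carrier ⊆ {z : ℂ | (D.pt 0).im < z.im} ∧
        D.carrier ∩ ball (D.pt 0) ρ = {z : ℂ | (D.pt 0).im < z.im} ∩ ball (D.pt 0) ρ ∧
        D.carrier ∩ ball (D.pt 1) ρ = {z : ℂ | (D.pt 1).im < z.im} ∩ ball (D.pt 1) ρ) →
      D.IsHullSubdomain D' → D.IsChordalUniformizing φ →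
      IsRestrictionMap (φ.pullbackHull D') Φ → HasRestrictionDeriv (φ.pullbackHull D') Φ d →
      (IsEmbEndpointApprox hexGraph hexCenter D a b ∧ ∀ᶠ δ : ℝ in 𝓝[>] 0,
        (∃ u : HexVertex, hexGraph.Adj (a δ) u ∧ ((δ : ℂ) * hexCenter u).im ≤ (D.pt 0).im) ∧
        (∃ u : HexVertex, hexGraph.Adj (b δ) u ∧ ((δ : ℂ) * hexCenter u).im ≤ (D.pt 1).im)) →
      Tendsto (fun δ : ℝ => ((hexSAWLaw D.carrier δ (a δ) (b δ))
        {γ | (∀ v ∈ γ.walk.support, v ∈ embMeshVertices hexCenter D'.carrier δ) ∧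
          ∀ e ∈ γ.walk.darts,
            (embMeshGraph hexGraph hexCenter D'.carrier δ).Adj e.fst e.snd}).toReal)
        (𝓝[>] 0) (𝓝 (d ^ ((5 : ℝ) / 8)))) :
    ∀ (D D' : DobrushinDomain) (ρ : ℝ) (a b : ℝ → HexVertex) (μ : Measure (CurveClass ℂ)),
      (0 < ρ ∧ (D.pt 1).im = (D.pt 0).im ∧ D.carrier ⊆ {z : ℂ | (D.pt 0).im < z.im} ∧
        D.carrier ∩ ball (D.pt 0) ρ = {z : ℂ | (D.pt 0).im < z.im} ∩ ball (D.pt 0) ρ ∧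
        D.carrier ∩ ball (D.pt 1) ρ = {z : ℂ | (D.pt 1).im < z.im} ∩ ball (D.pt 1) ρ) →
      IsEmbEndpointApprox hexGraph hexCenter D a b →
      (∀ᶠ δ : ℝ in 𝓝[>] 0,
        (a δ ∈ embMeshDomain hexGraph hexCenter D.carrier δ ∧
          ∃ w, hexGraph.Adj (a δ) w ∧ ¬ (hexDomainGraph D.carrier δ).Adj (a δ) w) ∧
        (b δ ∈ embMeshDomain hexGraph hexCenter D.carrier δ ∧
          ∃ w, hexGraph.Adj (b δ) w ∧ ¬ (hexDomainGraph D.carrier δ).Adj (b δ) w)) →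
      D.IsHullSubdomain D' → IsSLELaw ((8 : ℝ≥0) / 3) D μ →
      Tendsto (fun δ : ℝ =>
        ((hexSAWLaw D.carrier δ (a δ) (b δ)).map
            (fun γ : HexDomainSAW D.carrier δ (a δ) (b δ) => γ.curve))
          (CurveClass.rangeSubset (closure D'.carrier)))
        (𝓝[>] 0) (𝓝 (μ (CurveClass.rangeSubset (closure D'.carrier)))) := by
  intro D D' ρ a b μ hfl hab hbd hD' hμ
  obtain ⟨hρ, hpt, hDh, hflat0, hflat1⟩ := hfl
  -- (1) restriction data and the value
  obtain ⟨φ, Φ, d, hφ, hΦ, hd, hd0, hd1⟩ := stub_avoidanceCocycle_restrictionData D D' hD'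
  rw [measure_rangeSubset_closure_eq_of_isSLELaw hμ hD' hφ hΦ hd]
  -- (2) the endpoints are floor vertices
  have hend : IsEmbEndpointApprox hexGraph hexCenter D a b ∧ ∀ᶠ δ : ℝ in 𝓝[>] 0,
      (∃ u : HexVertex, hexGraph.Adj (a δ) u ∧ ((δ : ℂ) * hexCenter u).im ≤ (D.pt 0).im) ∧
      (∃ u : HexVertex, hexGraph.Adj (b δ) u ∧ ((δ : ℂ) * hexCenter u).im ≤ (D.pt 1).im) := by
    refine ⟨hab, ?_⟩
    filter_upwards [hbd, eventually_adj_mem_ball hρ hab.tendsto_fst,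
      eventually_adj_mem_ball hρ hab.tendsto_snd] with δ h hBa hBb
    obtain ⟨⟨haΩ, wa, hwa, hna⟩, ⟨hbΩ, wb, hwb, hnb⟩⟩ := h
    exact ⟨⟨wa, hwa, stub_avoidanceCocycle_floorEndpoint _ _ _ _ _ _ hflat0 (hBa _ (Or.inl rfl))
        (hBa _ (Or.inr hwa)) haΩ hwa hna⟩,
      ⟨wb, hwb, stub_avoidanceCocycle_floorEndpoint _ _ _ _ _ _ hflat1 (hBb _ (Or.inl rfl))
        (hBb _ (Or.inr hwb)) hbΩ hwb hnb⟩⟩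
  -- (3) the events
  set P : ℝ → ℝ≥0∞ := fun δ => ((hexSAWLaw D.carrier δ (a δ) (b δ)).map
      (fun γ : HexDomainSAW D.carrier δ (a δ) (b δ) => γ.curve))
    (CurveClass.rangeSubset (closure D'.carrier)) with hP
  have hPeq : ∀ δ, P δ = hexSAWLaw D.carrier δ (a δ) (b δ)
      {γ | γ.curve ∈ CurveClass.rangeSubset (closure D'.carrier)} := fun δ =>
    Measure.map_apply (EmbDomainSAW.measurable_of_top _)
      (CurveClass.measurableSet_rangeSubset isClosed_closure)
  set M : ∀ (D'' : DobrushinDomain) (δ : ℝ), Set (HexDomainSAW D.carrier δ (a δ) (b δ)) :=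
    fun D'' δ =>
    {γ : HexDomainSAW D.carrier δ (a δ) (b δ) |
      (∀ v ∈ γ.walk.support, v ∈ embMeshVertices hexCenter D''.carrier δ) ∧
      ∀ e ∈ γ.walk.darts, (embMeshGraph hexGraph hexCenter D''.carrier δ).Adj e.fst e.snd}
    with hM
  -- lower inclusion: `D'`-mesh walks stay in `closure D'`
  have hlow : ∀ δ, M D' δ ⊆ {γ | γ.curve ∈ CurveClass.rangeSubset (closure D'.carrier)} :=
    fun δ γ hγ => curve_mem_rangeSubset_of_meshWalk γ hγ.1 hγ.2
  -- upper inclusion: walks in `closure D'` are `D''`-mesh walks for `D'' ⊇ collar (D')`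
  have hup : ∀ (D'' : DobrushinDomain) (η : ℝ), 0 < η → D'.carrier ⊆ D''.carrier →
      (∀ z ∈ D.carrier, Metric.infDist z D'.carrier ≤ η → z ∈ D''.carrier) → ∀ δ,
      a δ ≠ b δ → {γ | γ.curve ∈ CurveClass.rangeSubset (closure D'.carrier)} ⊆ M D'' δ := by
    intro D'' η hη hsub'' hcol δ hne γ hγ
    have hrange : Set.range (γ.walk.toCurve fun v => (δ : ℂ) * hexCenter v) ⊆
        closure D'.carrier := hγ
    have hclD'' : ∀ z ∈ D.carrier, z ∈ closure D'.carrier → z ∈ D''.carrier := fun z hz hzc =>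
      hcol z hz (by rw [Metric.infDist_zero_of_mem_closure hzc]; exact hη.le)
    have hvert : ∀ v ∈ γ.walk.support, v ∈ embMeshVertices hexCenter D''.carrier δ := by
      intro v hv
      have hvΩ : v ∈ embMeshDomain hexGraph hexCenter D.carrier δ :=
        support_subset_embMeshDomain_of_ne γ hne v hv
      exact hclD'' _ (embMeshDomain_subset _ _ _ _ hvΩ)
        (hrange (SimpleGraph.Walk.mem_range_toCurve _ _ hv))
    refine ⟨hvert, fun e he => (embMeshGraph_adj_iff _ _).2 ⟨?_, ?_⟩⟩
    · exact embDomainGraph_le _ _ _ _ e.adj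
    · exact ((segment_subset_range_toCurve _ γ.walk e he).trans hrange).trans
        (closure_mono hsub'')
  -- (4) the squeeze, in `ℝ`
  have hc1 : d ^ ((5 : ℝ) / 8) ≤ 1 := Real.rpow_le_one hd0.le hd1 (by norm_num)
  have hc0 : 0 ≤ d ^ ((5 : ℝ) / 8) := Real.rpow_nonneg hd0.le _
  have hTlow := hFRL D D' ρ φ Φ d a b ⟨hρ, hpt, hDh, hflat0, hflat1⟩ hD' hφ hΦ hd hend
  have hne : ∀ᶠ δ : ℝ in 𝓝[>] 0, a δ ≠ b δ :=
    eventually_ne_of_tendsto_hexCenter (D.pt_injective.ne (by decide)) hab.tendsto_fst hab.tendsto_snd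
  have hprob := eventually_isProbabilityMeasure_hexSAWLaw hab
  have hreal : Tendsto (fun δ => (P δ).toReal) (𝓝[>] 0) (𝓝 (d ^ ((5 : ℝ) / 8))) := by
    refine tendsto_of_eventually_between fun ε hε => ?_
    obtain ⟨D'', Φ'', d'', η, hD'', hsub'', hη, hcol, hΦ'', hd'', hbound⟩ :=
      hullApprox_rootLocality D D' hD' φ Φ d hφ hΦ hd (ε / 2) (half_pos hε)
    have hTup := hFRL D D'' ρ φ Φ'' d'' a b ⟨hρ, hpt, hDh, hflat0, hflat1⟩ hD'' hφ hΦ'' hd'' hend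
    refine ⟨d ^ ((5 : ℝ) / 8) - ε / 2, d'' ^ ((5 : ℝ) / 8) + ε / 4, by linarith, ?_, ?_⟩
    · nlinarith
    · filter_upwards [Metric.tendsto_nhds.1 hTlow (ε / 2) (half_pos hε),
        Metric.tendsto_nhds.1 hTup (ε / 4) (by positivity), hne, hprob] with δ h1 h2 hneδ hPδ
      rw [Real.dist_eq] at h1 h2
      obtain ⟨h1a, -⟩ := abs_lt.1 h1
      obtain ⟨-, h2b⟩ := abs_lt.1 h2
      haveI := hPδ
      have hm1 : ((hexSAWLaw D.carrier δ (a δ) (b δ)) (M D' δ)).toReal ≤ (P δ).toReal := by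
        rw [hPeq]; exact ENNReal.toReal_mono (measure_ne_top _ _) (measure_mono (hlow δ))
      have hm2 : (P δ).toReal ≤ ((hexSAWLaw D.carrier δ (a δ) (b δ)) (M D'' δ)).toReal := by
        rw [hPeq]
        exact ENNReal.toReal_mono (measure_ne_top _ _)
          (measure_mono (hup D'' η hη hsub'' hcol δ hneδ))
      constructor <;> linarith
  -- back to `ℝ≥0∞`
  have hfin : ∀ᶠ δ : ℝ in 𝓝[>] 0, P δ ≠ ⊤ := hprob.mono fun δ hPδ => by
    haveI := hPδ
    rw [hPeq]; exact measure_ne_top _ _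
  refine (ENNReal.tendsto_ofReal hreal).congr' ?_
  filter_upwards [hfin] with δ hδ
  exact ENNReal.ofReal_toReal hδ

/-- The two route decls of DCS Conjecture 2 (repaired, stmt-CriticalPhenomena-14003) have identical bodies:
`SAWDefectDecoherence.HexObservableLimitR` (this line's statement 1) IS `SAWDevelopingMap.HexObservableLimit`
(crux-10472's hypothesis). [folklore] -/
theorem hexObservableLimitR_iff_hexObservableLimit :
    Summit.CriticalPhenomena.SAWScalingLimit.Theses.SAWDefectDecoherence.HexObservableLimitR ↔
      Summit.CriticalPhenomena.SAWScalingLimit.Theses.SAWDevelopingMap.HexObservableLimit :=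
  Iff.rfl

/-- **The floor-class avoidance cocycle from DCS Conjecture 2 and HALF-PLANE ARCH TIGHTNESS** (the line's lever in
positive form = crux-10472's anchor): `HexObservableLimitR → HalfPlaneArchTightness → HexAvoidanceCocycleFloor`, by
composing crux-10472's landed chain (short-chord locality reduction, restriction cocycle, canonical transfer under
the landed hull approximation) with the sandwich `hexAvoidanceCocycleFloor_of_floorRestrictionLimit`.
[cite: LawlerSchrammWerner2004SAW, §3.4 ("SAW satisfies restriction") and Prop. 2] -/
theorem hexAvoidanceCocycleFloor_of_archTightness
    (hO : Summit.CriticalPhenomena.SAWScalingLimit.Theses.SAWDefectDecoherence.HexObservableLimitR)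
    (hT : ∀ ε : ℝ, 0 < ε → ∃ K : ℝ, 0 < K ∧ ∀ (n : ℕ), 1 ≤ n → ∀ (Λ B : Finset HexVertex)
      (s t : Sym2 HexVertex), s ∈ hexDomainBoundary Λ → t ∈ hexDomainBoundary Λ → s ≠ t →
      dist (hexMidpoint s) (hexMidpoint t) ≤ n → (hexMidpoint t).im = (hexMidpoint s).im →
      (∀ v ∈ Λ, (hexMidpoint s).im < (hexCenter v).im) →
      (∀ v : HexVertex, v ∈ B ↔ ((hexMidpoint s).im < (hexCenter v).im ∧
        dist (hexCenter v) (hexMidpoint s) ≤ 2 * K * n)) →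
      (∑ γ : HexMidEdgeSAW Λ s t, if ∃ v ∈ γ.verts, K * n ≤ dist (hexCenter v) (hexMidpoint s)
        then hexCriticalFugacity ^ γ.length else 0) ≤
      ε * ∑ γ : HexMidEdgeSAW B s t, hexCriticalFugacity ^ γ.length) :
    ∀ (D D' : DobrushinDomain) (ρ : ℝ) (a b : ℝ → HexVertex) (μ : Measure (CurveClass ℂ)),
      (0 < ρ ∧ (D.pt 1).im = (D.pt 0).im ∧ D.carrier ⊆ {z : ℂ | (D.pt 0).im < z.im} ∧
        D.carrier ∩ ball (D.pt 0) ρ = {z : ℂ | (D.pt 0).im < z.im} ∩ ball (D.pt 0) ρ ∧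
        D.carrier ∩ ball (D.pt 1) ρ = {z : ℂ | (D.pt 1).im < z.im} ∩ ball (D.pt 1) ρ) →
      IsEmbEndpointApprox hexGraph hexCenter D a b →
      (∀ᶠ δ : ℝ in 𝓝[>] 0,
        (a δ ∈ embMeshDomain hexGraph hexCenter D.carrier δ ∧
          ∃ w, hexGraph.Adj (a δ) w ∧ ¬ (hexDomainGraph D.carrier δ).Adj (a δ) w) ∧
        (b δ ∈ embMeshDomain hexGraph hexCenter D.carrier δ ∧
          ∃ w, hexGraph.Adj (b δ) w ∧ ¬ (hexDomainGraph D.carrier δ).Adj (b δ) w)) →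
      D.IsHullSubdomain D' → IsSLELaw ((8 : ℝ≥0) / 3) D μ →
      Tendsto (fun δ : ℝ =>
        ((hexSAWLaw D.carrier δ (a δ) (b δ)).map
            (fun γ : HexDomainSAW D.carrier δ (a δ) (b δ) => γ.curve))
          (CurveClass.rangeSubset (closure D'.carrier)))
        (𝓝[>] 0) (𝓝 (μ (CurveClass.rangeSubset (closure D'.carrier)))) :=
  hexAvoidanceCocycleFloor_of_floorRestrictionLimit
    (canonicalTransfer_of_hullApprox hullApprox_rootLocality
      (stub_restrictionCocycle hO (stub_shortChordLocality_reduction hT)))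

end Summit.CriticalPhenomena.SAWScalingLimit.Theorems.HexConjecture.RootLocality

end
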